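import Mathlib
import Summits.Ventures.PercRepro2.Defs
import Summits.Ventures.PercRepro2.Graph
import Summits.Ventures.PercRepro2.Induced
import Summits.Ventures.PercRepro2.VdBKahn
import Summits.Ventures.PercRepro2.ReimerVdBK
import Summits.Ventures.PercRepro2.ReimerVdBKTwisted
import Summits.Ventures.PercRepro2.ReimerVdBKTied
import Summits.Ventures.PercRepro2.ReimerVdBKCoreDown
import Summits.Ventures.PercRepro2.ReimerVdBKDegTwoCalc
import Summits.Ventures.PercRepro2.ReimerVdBKOuter
import Summits.Ventures.PercRepro2.ReimerVdBKPatch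

/-!
# Outer stars of a revealed set; the left event on a pattern sub-cube
(blind cell PercRepro2, mine-c g49; `conjectures/MINE-C.md` §58 — part II of the proof that (OUTER-R) at
`N = ∅` is Harris for every revealed set `R ⊆ X ∪ Y`, `ReimerVdBKOuterOneWorld`)

The outer stars (`outerStar` of `ReimerVdBKOuter`) of distinct revealed vertices are disjoint
(`eq_of_mem_outerStar`); `outerEdges ends R W` collects the outer stars of `W ⊆ R`; the outer fibre of a
colouring is determined by the outer edges of `R` (`mem_outerFibre_of_agree`) and invariant under the flip
of the outer edges of any `W` (`flipOn_mem_outerFibre_iff`).  For the instance `(A, X; B, Y)` and a revealed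
set `R`: `FE` = the outer edges of `R`, `FX` = those of `R ∩ X` (world 1 avoids them), `FY` = those of
`R ∖ X` (world 2 avoids them when `R ⊆ X ∪ Y`).  THEOREM `preimage_twoWorld_eq`: on the sub-cube of a
pattern `d` the left event `twoWorld A X B Y` is `U₁(d) ∩ bar U₂(d)` for the two UPPER sets `upOne`,
`upTwo` of the free cube — the stars of `R ∩ X` are inert in world 1 and those of `R ∖ X` inert in world 2
(`conn_iff_of_avoid` of `ReimerVdBKPatch`), so the world-1 conditions of `A` and `X ∖ R` may be read on the
pattern with the `FX`-stars closed and the world-2 conditions of `B` and `Y ∖ R` on the pattern with the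
`FY`-stars closed in world 2.
-/

namespace Summit.Ventures.PercRepro2
namespace ReimerVdBK
open Classical

variable {V : Type*} {E : Type*} [Fintype E] [DecidableEq E] [Fintype V] [DecidableEq V]

/-! ## Outer stars and outer edge sets -/

section Stars
variable (ends : E → Sym2 V)

omit [DecidableEq E] in
/-- Membership in an outer star. -/
lemma mem_outerStar_iff {R : Finset V} {v : V} {e : E} :
    e ∈ outerStar ends R v ↔ ∃ w, ends e = s(v, w) ∧ w ∉ R := by
  simp [outerStar]

omit [DecidableEq E] in
/-- An outer star edge of `v` is incident to `v`. -/
lemma mem_ends_of_mem_outerStar {R : Finset V} {v : V} {e : E} (h : e ∈ outerStar ends R v) :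
    v ∈ ends e := by
  obtain ⟨w, hw, _⟩ := (mem_outerStar_iff ends).1 h
  rw [hw]
  exact Sym2.mem_mk_left v w

omit [DecidableEq E] in
/-- The outer stars of two revealed vertices are disjoint. -/
lemma eq_of_mem_outerStar {R : Finset V} {v v' : V} {e : E} (hv : v ∈ R) (h : e ∈ outerStar ends R v)
    (h' : e ∈ outerStar ends R v') : v = v' := by
  obtain ⟨w, hw, _⟩ := (mem_outerStar_iff ends).1 h
  obtain ⟨w', hw', hwR'⟩ := (mem_outerStar_iff ends).1 h'
  rw [hw] at hw'
  rcases Sym2.eq_iff.1 hw' with ⟨h1, _⟩ | ⟨h1, _⟩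
  · exact h1
  · exact (hwR' (h1 ▸ hv)).elim

variable (R : Finset V)

/-- The outer edges (relative to `R`) of the vertices of `W`. -/
def outerEdges (W : Finset V) : Finset E := W.biUnion (outerStar ends R)

/-- Membership in the outer edge set. -/
lemma mem_outerEdges_iff {W : Finset V} {e : E} :
    e ∈ outerEdges ends R W ↔ ∃ v ∈ W, e ∈ outerStar ends R v := by
  simp [outerEdges]

/-- The outer edge set is monotone in the vertex set. -/
lemma outerEdges_mono {W W' : Finset V} (h : W ⊆ W') : outerEdges ends R W ⊆ outerEdges ends R W' := by
  intro e he
  obtain ⟨v, hv, hve⟩ := (mem_outerEdges_iff ends R).1 he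
  exact (mem_outerEdges_iff ends R).2 ⟨v, h hv, hve⟩

/-- An edge incident to no vertex of `W` is not an outer edge of `W`. -/
lemma not_mem_outerEdges_of_not_incident {W : Finset V} {e : E} (h : ∀ w ∈ W, w ∉ ends e) :
    e ∉ outerEdges ends R W := by
  intro he
  obtain ⟨v, hv, hve⟩ := (mem_outerEdges_iff ends R).1 he
  exact h v hv (mem_ends_of_mem_outerStar ends hve)

/-- An outer star edge of `v ∈ R` is an outer edge of `W` iff `v ∈ W`. -/
lemma mem_outerEdges_iff_of_mem_outerStar {W : Finset V} {v : V} {e : E} (hv : v ∈ R)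
    (he : e ∈ outerStar ends R v) : e ∈ outerEdges ends R W ↔ v ∈ W := by
  constructor
  · intro h
    obtain ⟨v', hv', hve'⟩ := (mem_outerEdges_iff ends R).1 h
    rw [eq_of_mem_outerStar ends hv he hve']
    exact hv'
  · intro h
    exact (mem_outerEdges_iff ends R).2 ⟨v, h, he⟩

/-- The outer fibre of `c` at `R` is determined by the outer edges of `R`. -/
lemma mem_outerFibre_of_agree {c ω ω' : Config E} (h : ∀ e ∈ outerEdges ends R R, ω e = ω' e)
    (hω : ω ∈ outerFibre ends c R) : ω' ∈ outerFibre ends c R := by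
  intro v hv e he e' he'
  have hfe : e ∈ outerEdges ends R R := (mem_outerEdges_iff ends R).2 ⟨v, hv, he⟩
  have hfe' : e' ∈ outerEdges ends R R := (mem_outerEdges_iff ends R).2 ⟨v, hv, he'⟩
  rw [← h e hfe, ← h e' hfe']
  exact hω v hv e he e' he'

/-- The outer fibre is invariant under the flip of the outer edges of a part `W` of the revealed set. -/
lemma flipOn_mem_outerFibre_iff (W : Finset V) (c ω : Config E) :
    flipOn (outerEdges ends R W) ω ∈ outerFibre ends c R ↔ ω ∈ outerFibre ends c R := by
  have key : ∀ ω : Config E, ω ∈ outerFibre ends c R → flipOn (outerEdges ends R W) ω ∈ outerFibre ends c R := by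
    intro ω hω v hv e he e' he'
    have h1 := hω v hv e he e' he'
    by_cases hvW : v ∈ W
    · have : e ∈ outerEdges ends R W := (mem_outerEdges_iff_of_mem_outerStar ends R hv he).2 hvW
      have : e' ∈ outerEdges ends R W := (mem_outerEdges_iff_of_mem_outerStar ends R hv he').2 hvW
      rw [flipOn_of_mem _ ‹e ∈ outerEdges ends R W›, flipOn_of_mem _ ‹e' ∈ outerEdges ends R W›]
      revert h1
      cases ω e <;> cases ω e' <;> cases c e <;> cases c e' <;> decide
    · have : e ∉ outerEdges ends R W := fun h => hvW ((mem_outerEdges_iff_of_mem_outerStar ends R hv he).1 h)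
      have : e' ∉ outerEdges ends R W :=
        fun h => hvW ((mem_outerEdges_iff_of_mem_outerStar ends R hv he').1 h)
      rw [flipOn_of_not_mem _ ‹e ∉ outerEdges ends R W›, flipOn_of_not_mem _ ‹e' ∉ outerEdges ends R W›]
      exact h1
  refine ⟨fun h => ?_, key ω⟩
  have := key _ h
  rwa [flipOn_involutive] at this

end Stars

/-! ## The left event on a pattern sub-cube -/

section Main
variable (ends : E → Sym2 V) (s : V) (A X B Y R : Finset V)

/-- The outer edges of the revealed set. -/
def FE : Finset E := outerEdges ends R R
/-- The outer edges of the revealed vertices avoided by world 1. -/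
def FX : Finset E := outerEdges ends R (R ∩ X)
/-- The outer edges of the revealed vertices avoided by world 2. -/
def FY : Finset E := outerEdges ends R (R \ X)

/-- The upper event `U₁(d)` on the free cube: `A` connected in world 1 with the stars of `R ∩ X` closed,
`R ∖ X` avoided in world 2, `Y ∖ R` avoided in world 2 with the stars of `R ∖ X` closed. -/
def upOne (d : Config E) : Set (Config {e : E // e ∉ FE ends R}) :=
  patch (FE ends R) (setOn (FX ends X R) false d) ⁻¹' connAll ends s A ∩
    patch (FE ends R) d ⁻¹' bar (avoidAll ends s (R \ X)) ∩
    patch (FE ends R) (setOn (FY ends X R) true d) ⁻¹' bar (avoidAll ends s (Y \ R))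

/-- The upper event `U₂(d)` on the free cube (the `bar` of the lower part of the left event). -/
def upTwo (d : Config E) : Set (Config {e : E // e ∉ FE ends R}) :=
  patch (FE ends R) (compl d) ⁻¹' bar (avoidAll ends s (R ∩ X)) ∩
    patch (FE ends R) (compl (setOn (FX ends X R) false d)) ⁻¹' bar (avoidAll ends s (X \ R)) ∩
    patch (FE ends R) (compl (setOn (FY ends X R) true d)) ⁻¹' connAll ends s B

/-- `U₁(d)` is an upper set. -/
lemma isUpperSet_upOne (d : Config E) : IsUpperSet (upOne ends s A X Y R d) := by
  refine IsUpperSet.inter (IsUpperSet.inter ?_ ?_) ?_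
  · exact (isUpperSet_connAll ends s A).preimage (patch_mono _ _)
  · exact (isUpperSet_bar_of_isLowerSet (isLowerSet_avoidAll ends s _)).preimage (patch_mono _ _)
  · exact (isUpperSet_bar_of_isLowerSet (isLowerSet_avoidAll ends s _)).preimage (patch_mono _ _)

/-- `U₂(d)` is an upper set. -/
lemma isUpperSet_upTwo (d : Config E) : IsUpperSet (upTwo ends s X B R d) := by
  refine IsUpperSet.inter (IsUpperSet.inter ?_ ?_) ?_
  · exact (isUpperSet_bar_of_isLowerSet (isLowerSet_avoidAll ends s _)).preimage (patch_mono _ _)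
  · exact (isUpperSet_bar_of_isLowerSet (isLowerSet_avoidAll ends s _)).preimage (patch_mono _ _)
  · exact (isUpperSet_connAll ends s B).preimage (patch_mono _ _)

/-- Closing the outer stars of `R ∩ X` on a pattern gives a smaller patched configuration. -/
lemma patch_setOn_FX_le (d : Config E) (ω' : Config {e : E // e ∉ FE ends R}) :
    patch (FE ends R) (setOn (FX ends X R) false d) ω' ≤ patch (FE ends R) d ω' := by
  refine patch_le_patch _ (fun e _ => ?_) ω'
  by_cases he : e ∈ FX ends X R
  · rw [setOn_of_mem _ he]
    exact Bool.false_le _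
  · rw [setOn_of_not_mem _ he]

/-- Closing the outer stars of `R ∖ X` in world 2 gives a smaller world-2 configuration. -/
lemma patch_compl_setOn_FY_le (d : Config E) (ω' : Config {e : E // e ∉ FE ends R}) :
    patch (FE ends R) (compl (setOn (FY ends X R) true d)) ω' ≤ patch (FE ends R) (compl d) ω' := by
  refine patch_le_patch _ (fun e _ => ?_) ω'
  rw [compl_setOn]
  by_cases he : e ∈ FY ends X R
  · rw [setOn_of_mem _ he]
    exact Bool.false_le _
  · rw [setOn_of_not_mem _ he]

/-- The two patched configurations of `patch_setOn_FX_le` agree off the stars of `R ∩ X`. -/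
lemma patch_setOn_FX_agree (d : Config E) (ω' : Config {e : E // e ∉ FE ends R}) (e : E)
    (h : ∀ w ∈ R ∩ X, w ∉ ends e) :
    patch (FE ends R) (setOn (FX ends X R) false d) ω' e = patch (FE ends R) d ω' e := by
  have he : e ∉ FX ends X R := not_mem_outerEdges_of_not_incident ends R h
  by_cases hF : e ∈ FE ends R
  · rw [patch_of_mem _ hF, patch_of_mem _ hF, setOn_of_not_mem _ he]
  · rw [patch_of_not_mem _ hF, patch_of_not_mem _ hF]

/-- The two patched configurations of `patch_compl_setOn_FY_le` agree off the stars of `R ∖ X`. -/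
lemma patch_compl_setOn_FY_agree (d : Config E) (ω' : Config {e : E // e ∉ FE ends R}) (e : E)
    (h : ∀ w ∈ R \ X, w ∉ ends e) :
    patch (FE ends R) (compl (setOn (FY ends X R) true d)) ω' e = patch (FE ends R) (compl d) ω' e := by
  have he : e ∉ FY ends X R := not_mem_outerEdges_of_not_incident ends R h
  by_cases hF : e ∈ FE ends R
  · rw [patch_of_mem _ hF, patch_of_mem _ hF, compl_setOn, setOn_of_not_mem _ he]
  · rw [patch_of_not_mem _ hF, patch_of_not_mem _ hF]

/-- An outer edge of `R` incident to `w ∈ R` is an outer star edge of `w`. -/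
lemma mem_outerStar_of_mem_FE {w : V} {e : E} (hw : w ∈ R) (he : e ∈ FE ends R) (hwe : w ∈ ends e) :
    e ∈ outerStar ends R w := by
  obtain ⟨v, hv, hve⟩ := (mem_outerEdges_iff ends R).1 he
  obtain ⟨u, hu, huR⟩ := (mem_outerStar_iff ends).1 hve
  rw [hu] at hwe
  rcases Sym2.mem_iff.1 hwe with rfl | rfl
  · exact hve
  · exact (huR hw).elim

/-- The outer edges of `R` are those of `R ∩ X` together with those of `R ∖ X`. -/
lemma mem_FX_or_FY {e : E} (he : e ∈ FE ends R) : e ∈ FX ends X R ∨ e ∈ FY ends X R := by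
  obtain ⟨v, hv, hve⟩ := (mem_outerEdges_iff ends R).1 he
  by_cases hvX : v ∈ X
  · exact Or.inl ((mem_outerEdges_iff ends R).2 ⟨v, Finset.mem_inter.2 ⟨hv, hvX⟩, hve⟩)
  · exact Or.inr ((mem_outerEdges_iff ends R).2 ⟨v, Finset.mem_sdiff.2 ⟨hv, hvX⟩, hve⟩)

/-- **The left event on the sub-cube of `d` is `U₁(d) ∩ bar U₂(d)`.** -/
lemma preimage_twoWorld_eq (hR : R ⊆ X ∪ Y) (hXY : X ∩ Y = ∅) (d : Config E) :
    patch (FE ends R) d ⁻¹' twoWorld ends s A X B Y =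
      upOne ends s A X Y R d ∩ bar (upTwo ends s X B R d) := by
  ext ω'
  simp only [Set.mem_preimage, twoWorld, Set.mem_inter_iff, mem_bar, upOne, upTwo, connAll, avoidAll,
    Set.mem_setOf_eq, compl_patch, compl_compl]
  -- the two inertness equivalences
  have hin1 : (∀ w ∈ R ∩ X, ¬ Conn ends (patch (FE ends R) d ω') s w) → ∀ u,
      Conn ends (patch (FE ends R) d ω') s u ↔
        Conn ends (patch (FE ends R) (setOn (FX ends X R) false d) ω') s u :=
    fun hav u => conn_iff_of_avoid ends s (R ∩ X) (patch_setOn_FX_le ends X R d ω')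
      (fun e he => patch_setOn_FX_agree ends X R d ω' e he) hav u
  have hin2 : (∀ w ∈ R \ X, ¬ Conn ends (patch (FE ends R) (compl d) (compl ω')) s w) → ∀ u,
      Conn ends (patch (FE ends R) (compl d) (compl ω')) s u ↔
        Conn ends (patch (FE ends R) (compl (setOn (FY ends X R) true d)) (compl ω')) s u :=
    fun hav u => conn_iff_of_avoid ends s (R \ X) (patch_compl_setOn_FY_le ends X R d (compl ω'))
      (fun e he => patch_compl_setOn_FY_agree ends X R d (compl ω') e he) hav u
  constructor
  · rintro ⟨⟨hA, hX⟩, hB, hY⟩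
    have hav1 : ∀ w ∈ R ∩ X, ¬ Conn ends (patch (FE ends R) d ω') s w :=
      fun w hw => hX w (Finset.mem_inter.1 hw).2
    have hav2 : ∀ w ∈ R \ X, ¬ Conn ends (patch (FE ends R) (compl d) (compl ω')) s w := by
      intro w hw
      have hwR := (Finset.mem_sdiff.1 hw).1
      have hwX := (Finset.mem_sdiff.1 hw).2
      have hwY : w ∈ Y := by
        rcases Finset.mem_union.1 (hR hwR) with h | h
        · exact absurd h hwX
        · exact h
      exact hY w hwY
    refine ⟨⟨⟨fun a ha => (hin1 hav1 a).1 (hA a ha), hav2⟩, fun y hy => ?_⟩,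
      ⟨hav1, fun x hx => ?_⟩, fun b hb => (hin2 hav2 b).1 (hB b hb)⟩
    · exact fun h => hY y (Finset.mem_sdiff.1 hy).1 ((hin2 hav2 y).2 h)
    · exact fun h => hX x (Finset.mem_sdiff.1 hx).1 ((hin1 hav1 x).2 h)
  · rintro ⟨⟨⟨hA, hav2⟩, hY'⟩, ⟨hav1, hX'⟩, hB⟩
    refine ⟨⟨fun a ha => (hin1 hav1 a).2 (hA a ha), fun x hx => ?_⟩,
      fun b hb => (hin2 hav2 b).2 (hB b hb), fun y hy => ?_⟩
    · by_cases hxR : x ∈ R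
      · exact hav1 x (Finset.mem_inter.2 ⟨hxR, hx⟩)
      · exact fun h => hX' x (Finset.mem_sdiff.2 ⟨hx, hxR⟩) ((hin1 hav1 x).1 h)
    · by_cases hyR : y ∈ R
      · have hyX : y ∉ X := fun hyX => Finset.notMem_empty y (hXY ▸ Finset.mem_inter.2 ⟨hyX, hy⟩)
        exact hav2 y (Finset.mem_sdiff.2 ⟨hyR, hyX⟩)
      · exact fun h => hY' y (Finset.mem_sdiff.2 ⟨hy, hyR⟩) ((hin2 hav2 y).1 h)

end Main

end ReimerVdBK
end Summit.Ventures.PercRepro2
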